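import Summits.Langlands.Langlands.Theses.SkinnerWilesDefectOne
import Summits.Langlands.Langlands.Theorems.EisensteinProModularSeed.Negative.OrientedFrame
import Summits.Langlands.Langlands.Theorems.EisensteinProModularSeed.Negative.BorelAndEisenstein
import Literature.NumberTheory.EllipticCurves.FramedTateGaloisRep
import Literature.NumberTheory.Automorphic.BCDTModularity

/-!
# Line `big-image-cousin` — checked skeleton for the crux `EisensteinProModularSeed`
(item stmt-Langlands-12920 · route `SkinnerWilesDefectOne`, rank 3 · sub-problem Langlands/Langlands)

Crux (by name: `Summit.Langlands.Langlands.Theses.SkinnerWilesDefectOne.EisensteinProModularSeed`;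
re-bracketed `crux_iff` below): for `F` imaginary quadratic, `p` odd, `O = 𝒪_{ℚ̄_p}` and every
ADMISSIBLE datum `(ρ, ρ₀)` (`Hyps`: `ρ : Γ_F → GL₂(ℚ̄_p)` continuous irreducible, a.e. unramified,
with a residually upper-triangular integral model `ρ₀` — ordered residual pair
`(χ̄_a, χ̄_b) = ((ρ₀)₀₀, (ρ₀)₁₁) mod 𝔪` —, `p`-distinguished and ORIENTED-ordinary of one parallel
weight at every `v ∣ p`), the conclusion `Concl p O ρ₀`: a tame level `𝒰`, an IRREDUCIBLE
`p`-adically automorphic `r` of level `𝒰` with an integral model `r₀` of the SAME ordered residual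
diagonal, oriented-ordinary of some parallel weight, and ONE auxiliary place `q` off which (and off
`p`, off the residual conductor) `𝒰` is hyperspecial.

## The line (idea card `Ideas/big-image-cousin.md` ≈ `Ideas/ell-switch-geometric-seed.md`, with
## `Ideas/descend-raise-basechange.md` as its descended stub; triage TRIAGE-r1-{1,2,3}: pass ×3)

LEVER.  Do not manufacture the seed `r` by an Eisenstein congruence (Disproof §7: every congruence
road in print is degree-one = MIXED-oriented or torsion, DEAD for the typed clause).  Take instead a
MODULAR ELLIPTIC CURVE `E′/F` — a COUSIN — whose `F`-rational `p`-isogeny `⟨P⟩ ⊂ E′[p]` realises the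
residual pair ON THE NOSE (`σP = χ̄_a(σ)P`, `σQ ≡ χ̄_b(σ)Q mod ⟨P⟩`; this file is TWIST-FREE, see
"Scope"), certified modular at the SECOND prime `3` where its image is big
(`SL₂(𝔽₃) ⊆ im ρ̄_{E′,3}` ⇒ Caraiani–Newton 2023 Cor. 6.1.1(1) / Thm. 7.1(2), arXiv:2301.10509
pp. 87, 91: every such `E′` over every imaginary quadratic `F` is modular) — Wiles' 3–5 switch run
backwards.  Then `r := V_p(E′)` framed on a `ℤ_p`-basis `(P̃, Q̃)` of `T_pE′` lifting `(P, Q)` is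
irreducible (`V_p` irreducible: part of the cousin datum), `p`-adically automorphic of tame level
"bad places of `E′` ∪ `{v ∣ p}`" (the DICTIONARY `stub_dictionary`: weight-0 cuspidal `π` ⇒ continuous
`ℚ̄_p`-point of `𝕋(𝒰)`, arithmetic normalisation `x(T_{v,1}) = tr`, `q_v x(T_{v,2}) = det` fixed by
`Negative.BorelAndEisenstein`), has the upper-triangular integral model `r₀` with EXACTLY the residual
diagonal of `ρ₀`, and is ORIENTED-ordinary of weight `(k′, m′) = (2, 1)` at every `v ∣ p` where `E′`
has good reduction with `P` fixed by inertia (the ordinary line of `V_pE′|_{D_v}` = Tate module of the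
formal group reduces OUTSIDE `⟨P̄⟩`, i.e. `‖Q₀₀‖ ≤ ‖Q₁₀‖` — equivalently unit root `≡ χ̄_a`, the LANDED
converse orientation lemma `Negative.oriented_of_unitRoot_congr_toLocal`, p75384).  The crux's ONE-`q`
level clause becomes: `E′` has good reduction at every residually-unramified `v ∤ p` except `q` — on
the twisted modular curve `X_{χ̄_a}(p) ≅ ℙ¹_F` (`p ∈ {5, 7}`, one `F`-point given) an `S`-INTEGRALITY
condition on the Hauptmodul with ONE floating prime (`stub_cousinSupply`, the honest Diophantine
crux-within-the-crux; witness for a genuine quartic datum over `ℚ(√-2)`, `p = 5`, `N(q) = 113`: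
kit j008657, certified `GL₂(𝔽₃)`-image in TRIAGE-r1-1 App. B).  DESCENDED data (ratio `χ̄_b/χ̄_a`
extends to `Γ_ℚ`) are seeded instead by Billerey–Menares level raising over `ℚ` at ONE prime inert in
`F` + quadratic base change (`stub_descendedSeed`, card `descend-raise-basechange`).

## Stubs (6) and composition

* D1 `stub_dictionary` — `Dictionary F p`: weight-0 cuspidal `π` on `GL₂(𝔸_F)` + a framed `r`
  Satake–Frobenius-matched with `π` outside a finite `S` (and off `p`) ⇒ `∃ 𝒰`, `𝒰.bad ⊆ S ∪ S_p`,
  `𝒰.IsPadicallyAutomorphic r`.  [M/L; Eichler–Shimura–Harder + integrality + completion; SHARED by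
  every line of this crux and, reversed, by the exit crux stmt-Langlands-12921]
* S  `stub_bigImageModularity` — `BigImageModularity F p`: CN23 Cor. 6.1.1(1)/Thm. 7.1(2) for curves with
  `SL₂(𝔽₃) ⊆ im ρ̄_{E,3}`, conclusion = weight-0 `π` with Satake–Frobenius matching against `V_pE` at
  EVERY good place `w ∤ p` ("same `L`-function").  [published theorem; XL to formalise]
* K2 `stub_cousinSeed` — `Hyps → BigImageModularity F p → Dictionary F p → Cousin O ρ₀ → Concl p O ρ₀`
  (`p ≥ 5`): the structural heart (adapted lattice, `DiagCongr`, irreducibility transport, ordinary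
  frame at good ordinary `v ∣ p` + landed orientation lemma, level bookkeeping).  [L; provable now
  modulo the connected–étale structure of `T_pE′` at good ordinary `v` (Serre–Tate), a cite-able fact]
* K1 `stub_cousinSupply` — `(p = 5 ∨ p = 7) → RealizedByCurve O ρ₀ → Cousin O ρ₀`: the SUPPLY of clean
  modular cousins with one auxiliary place.  [OPEN as a universal statement (prime/`S`-unit values on a
  polylog-thin set); finite search per datum; HARDEST stub of the line's own mechanism]
* K3 `stub_descendedSeed` — `Hyps → Dictionary F p → Descended O ρ₀ → Concl p O ρ₀`.  [L/XL; theorem-grade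
  in print for Serre weights `2 ≤ k ≤ p-2` with `p`-unramified characters (BM18 Thm 2, arXiv:1604.01173
  p. 3 + Carayol + Hida's weight-2 member + Langlands quadratic base change at ONE inert prime, which
  always exists by parity, TRIAGE-r1-3); corners listed at the stub]
* R  `stub_residualSeed` — `Hyps → ¬Descended → ¬((p = 5 ∨ p = 7) ∧ RealizedByCurve) → Concl`: the
  RESIDUAL population (genuine non-elliptic-type pairs, `p ∉ {5,7}`, and elliptic-type pairs realisable
  only after a Teichmüller twist).  [OPEN; = the crux restricted there; NO mechanism in this line
  (coverage map of TRIAGE-r1-2); `residualSeed_of_crux` below certifies it is no stronger than the crux]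

Composition (sorry-free, kernel-checked): `EisensteinProModularSeed_of : EisensteinProModularSeed`
= `crux_iff` + `by_cases Descended` (K3 ∘ D1) + `by_cases (p ∈ {5,7}) ∧ RealizedByCurve`
(K2 ∘ S ∘ D1 ∘ K1) + R.

## Scope ("twist-free", deliberate) and what a reshape can widen

The cards realise a general elliptic-type pair as `V_p(E′) ⊗ η̃` with a Teichmüller twist `η̃`.
Concl is twist-equivariant on paper (card P2), but in the tree the twist costs global class field
theory (Galois character ⇒ Hecke character), the automorphic twist of `π` and — for cousins with
additive potentially-good reduction where `η̄` ramifies — local–global compatibility at ramified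
places (Varma; Allen–Newton monodromy).  v1 keeps K2 provable from S + D1 alone by demanding the pair ON
THE NOSE (`χ̄_a` is then `𝔽_p^×`-valued and `χ̄_aχ̄_b = ω`: exactly the route's headline 5-isogeny
population `FiveIsogenyEllipticCurves` and the certified `ℚ(√-2)` witness); twist-needing elliptic data
sit in R until a lead files the P2 reshape (`stub_twistEquivariance : Concl(ρ₀ ⊗ η̃⁻¹) → Concl ρ₀` for
`cond η̄ ⊆ cond χ̄ ∪ S_p`, plus K1/K2 for the twisted datum).

## Disproof.lean (cdisprove gen 2, d48643eb; READ) — what is honoured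

* No `_false_without_` theorem exists for this crux (Disproof §3/§5: none provable) — nothing to thread.
* `crux_iff_rebracketed` / `crux_iff_pairSeedArising` / `concl_congr`: our `crux_iff` is the same
  re-bracketing; every stub consumes `ρ` only through `Hyps` (a.e.-unramifiedness gives the finite `S`
  of K2; `p`-distinguishedness is available but K2's orientation argument does not even need it).
* `seedNoLevel_of_engine` (the ONE-`q` clause is the whole content): the line attacks exactly that
  clause, by an object other than `ρ` (K1 = `S`-integrality with one floating prime); no stub drops it.
* `orientedFrame_diag_congr` / `oriented_of_unitRoot_congr` (LANDED `Negative/OrientedFrame.lean`,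
  p75384, imported): K2's orientation step IS this lemma (unit root `≡ χ̄_a = (r₀ σ)₀₀`); the cards'
  cheapest falsifier (a) is thereby settled positively.
* `inertial_type_of_orientedOrdinary`: a weight-`(2,1)` cousin forces `χ̄_a` unramified and
  `χ̄_b = ω` on `I_v` — consistent: `RealizedByCurve` demands `P` inertia-fixed at `v ∣ p` and K1/K2
  deliver good ordinary cousins; data of other inertial type are in R (honest).
* `eigensystem_apply_eq_zero_of_nsmul_eq_zero` (B1, torsion gives no `ℚ̄_p`-point): no stub touches a
  torsion class; the point of `𝕋(𝒰)` comes from a characteristic-0 weight-0 `π` (D1).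
* `not_isIrreducible_of_conj_upperTriangular` / `eisenstein_congruence_of_seed_conclusion` (LANDED
  `Negative/BorelAndEisenstein.lean`, p75392, imported): our `r` is irreducible by the cousin's
  `V_p`-irreducibility clause (never Borel-shaped), and D1's normalisation (`x(T_{v,1}) = √q(α+β)`,
  `x(T_{v,2}) = αβ`, arithmetic Frobenius `X² - a_vX + q_v`) is the one these lemmas pin.
* §7 C/D (Berger-type congruences dead; live mechanisms = base change + geometric): K3 and K1/K2 are
  precisely those two; the item's "intended proof" is not used anywhere.
* Negatives index (`ledger negatives --problem Langlands`): one entry (stmt-Langlands-3797, K3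
  Kuga–Satake anchor) — unrelated; no stub restates a refuted statement.
-/

set_option linter.dupNamespace false

noncomputable section

namespace Summit.Langlands.Langlands.Cruxes.EisensteinProModularSeed.BigImageCousin

open Summit.Langlands.Langlands.Theses.SkinnerWilesDefectOne
open Literature.NumberTheory.Automorphic Literature.NumberTheory.GaloisRepresentations
open Literature.NumberTheory.Automorphic.BigHeckeGLn
open NumberField IsDedekindDomain IsLocalRing Filter Field
open scoped Matrix MatrixGroups

/-! ## §0 Anatomy of the crux (verbatim the defs of `Cruxes/…/Disproof.lean` §0, re-declared here
because the disprover's work file is not an import target; `crux_iff` is its `crux_iff_rebracketed`) -/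

section Anatomy

variable {F : Type} [Field F] [NumberField F] (p : ℕ) [Fact p.Prime]
  (O : ValuationSubring (PadicAlgCl p))

/-- The ORIENTED ordinarity clause at `v` with weight `k` and inertial exponent `m` (verbatim the
route's inline clause, = `Disproof.OrientedOrdinaryAt`). [folklore] -/
def OrientedOrdinaryAt (r : FramedGaloisRep F (PadicAlgCl p) 2) (v : HeightOneSpectrum (𝓞 F))
    (k m : ℕ) : Prop :=
  ∃ Q : Matrix.GeneralLinearGroup (Fin 2) (PadicAlgCl p),
    Valued.v (Q.val 0 0) ≤ Valued.v (Q.val 1 0) ∧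
    ∀ σ, (Q⁻¹ * r.toLocal v σ * Q).val 1 0 = 0 ∧
      (σ ∈ absInertia (v.adicCompletion F) →
        (Q⁻¹ * r.toLocal v σ * Q).val 1 1 ^ m = 1 ∧
        (Q⁻¹ * r.toLocal v σ * Q).val 0 0 ^ m =
          algebraMap (Padic p) (PadicAlgCl p)
            (((GaloisRep.cyclotomicCharacter (v.adicCompletion F) p σ).val : PadicInt p) :
              Padic p) ^ ((k - 1) * m))

/-- Oriented-ordinary of ONE parallel weight `k ≥ 2`, one exponent `m > 0`, at every `v ∣ p`
(= `Disproof.OrientedOrdinary`). [folklore] -/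
def OrientedOrdinary (r : FramedGaloisRep F (PadicAlgCl p) 2) : Prop :=
  ∃ k : ℕ, 2 ≤ k ∧ ∃ m : ℕ, 0 < m ∧ ∀ v : HeightOneSpectrum (𝓞 F),
    (p : 𝓞 F) ∈ v.asIdeal → OrientedOrdinaryAt p r v k m

/-- The HYPOTHESIS PACKAGE of the crux on `(ρ, ρ₀)` (= `Disproof.Hyps`). [folklore] -/
def Hyps (ρ : FramedGaloisRep F (PadicAlgCl p) 2)
    (ρ₀ : absoluteGaloisGroup F →* Matrix.GeneralLinearGroup (Fin 2) O) : Prop :=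
  ρ.toGaloisRep.IsIrreducible ∧ (∀ᶠ v in cofinite, ρ.IsUnramifiedAt v) ∧
    ρ.HasUpperTriangularIntegralModel ρ₀ ∧
    ∃ k : ℕ, 2 ≤ k ∧ ∃ m : ℕ, 0 < m ∧ ∀ v : HeightOneSpectrum (𝓞 F),
      (p : 𝓞 F) ∈ v.asIdeal → IsPDistinguishedAt ρ₀ v ∧ OrientedOrdinaryAt p ρ v k m

variable {p}

/-- Both residual diagonal characters of `ρ₀` are unramified at `v` (= `Disproof.ResiduallyUnramifiedAt`,
the route's inline clause). [folklore] -/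
def ResiduallyUnramifiedAt (ρ₀ : absoluteGaloisGroup F →* Matrix.GeneralLinearGroup (Fin 2) O)
    (v : HeightOneSpectrum (𝓞 F)) : Prop :=
  ∀ 𝔓 ∈ v.primesAbove, ∀ σ ∈ 𝔓.inertia (absoluteGaloisGroup F),
    ((ρ₀ σ).val 0 0 - 1 : O) ∈ maximalIdeal O ∧ ((ρ₀ σ).val 1 1 - 1 : O) ∈ maximalIdeal O

/-- Same ORDERED residual diagonal (= `Disproof.DiagCongr`). [folklore] -/
def DiagCongr (r₀ ρ₀ : absoluteGaloisGroup F →* Matrix.GeneralLinearGroup (Fin 2) O) : Prop :=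
  ∀ g, ((r₀ g).val 0 0 - (ρ₀ g).val 0 0 : O) ∈ maximalIdeal O ∧
    ((r₀ g).val 1 1 - (ρ₀ g).val 1 1 : O) ∈ maximalIdeal O

variable (p)

/-- The CONCLUSION of the crux for the residual datum `ρ₀` (= `Disproof.Concl`; mentions `ρ₀` only). [folklore] -/
def Concl (ρ₀ : absoluteGaloisGroup F →* Matrix.GeneralLinearGroup (Fin 2) O) : Prop :=
  ∃ (𝒰 : TameLevel 2 F p) (r : FramedGaloisRep F (PadicAlgCl p) 2)
    (r₀ : absoluteGaloisGroup F →* Matrix.GeneralLinearGroup (Fin 2) O)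
    (q : HeightOneSpectrum (𝓞 F)),
    r.toGaloisRep.IsIrreducible ∧ 𝒰.IsPadicallyAutomorphic r ∧
      r.HasUpperTriangularIntegralModel r₀ ∧ DiagCongr O r₀ ρ₀ ∧ OrientedOrdinary p r ∧
      ∀ v : HeightOneSpectrum (𝓞 F), v ≠ q → (p : 𝓞 F) ∉ v.asIdeal →
        ResiduallyUnramifiedAt O ρ₀ v → v ∉ 𝒰.bad

end Anatomy

/-- **Anatomy.** The crux is, verbatim up to bracketing, `∀ data, Hyps → Concl` (same six-line proof
as `Disproof.crux_iff_rebracketed`). [folklore] -/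
theorem crux_iff :
    EisensteinProModularSeed ↔
      ∀ (F : Type) [Field F] [NumberField F], IsTotallyComplex F → Module.finrank ℚ F = 2 →
        ∀ (p : ℕ) [Fact p.Prime], p ≠ 2 → ∀ (O : ValuationSubring (PadicAlgCl p)),
          O = (Valued.v : Valuation (PadicAlgCl p) NNReal).valuationSubring →
          ∀ (ρ : FramedGaloisRep F (PadicAlgCl p) 2)
            (ρ₀ : absoluteGaloisGroup F →* Matrix.GeneralLinearGroup (Fin 2) O),
            Hyps p O ρ ρ₀ → Concl p O ρ₀ := by
  constructor
  · intro h F _ _ hF hdeg p _ hp O hO ρ ρ₀ hh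
    obtain ⟨hirr, hunr, hmod, hloc⟩ := hh
    exact h F hF hdeg p hp O hO ρ ρ₀ hirr hunr hmod hloc
  · intro h F _ _ hF hdeg p _ hp O hO ρ ρ₀ hirr hunr hmod hloc
    exact h F hF hdeg p hp O hO ρ ρ₀ ⟨hirr, hunr, hmod, hloc⟩

/-! ## §1 The two regimes of the line and the cousin datum -/

section Regimes

variable {F : Type} [Field F] [NumberField F] {p : ℕ} [Fact p.Prime]
  (O : ValuationSubring (PadicAlgCl p))

/-- **DESCENDED datum**: the residual RATIO `χ̄_b χ̄_a⁻¹` extends to a character of `Γ_ℚ`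
(`Γ_F ↪ Γ_ℚ` by the tree's `absGaloisRestrict ℚ F`), i.e. is invariant under complex conjugation —
the base-change regime of card `descend-raise-basechange` (there called R1 / "c-invariant ratio").
For a residually upper-triangular `ρ₀` the two `residualDiag`s are characters, and a
`Γ_ℚ`-extension exists iff the ratio is `c`-invariant (index `2`, `κ = 𝔽̄_p` closed under square
roots). [folklore] -/
def Descended (ρ₀ : absoluteGaloisGroup F →* Matrix.GeneralLinearGroup (Fin 2) O) : Prop :=
  ∃ θ : absoluteGaloisGroup ℚ →* ResidueField O,
    ∀ σ : absoluteGaloisGroup F,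
      residualDiag ρ₀ 1 σ = θ (absGaloisRestrict ℚ F σ) * residualDiag ρ₀ 0 σ

/-- **REALISED BY A CURVE (twist-free, clean above `p`)**: some elliptic curve `E/F` carries an
`F`-rational cyclic `p`-isogeny `⟨P⟩ ⊂ E[p]` whose ORDERED pair of characters IS the residual pair of
`ρ₀` — `σP = aP`, `σQ = bP + dQ` with `(ρ₀ σ)₀₀ ≡ a`, `(ρ₀ σ)₁₁ ≡ d (mod 𝔪)`, `(P, Q)` a basis of
`E[p]` — and whose kernel is UNRAMIFIED at every `v ∣ p` (`P` fixed by inertia: the only position in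
which a good-reduction cousin can be oriented, `Negative.inertial_type_of_orientedOrdinary` with
`m = 1`).  The `F`-points of the twisted modular curve `X_{χ̄_a}(p)`; for `p ∈ {5, 7}` one point makes it
`ℙ¹_F` (X₁(5) → X₀(5) is a conic — TRIAGE-r1-2 (iv)/r1-3 sharpen 1 —, and the degree-3 twist of X₁(7)
is split by an odd extension).  Forces `χ̄_a` to be `𝔽_p^×`-valued and `χ̄_aχ̄_b = ω` (Weil pairing).
[folklore] -/
def RealizedByCurve (ρ₀ : absoluteGaloisGroup F →* Matrix.GeneralLinearGroup (Fin 2) O) : Prop :=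
  ∃ (E : WeierstrassCurve F) (P Q : E.geomTorsion p),
    E.Δ ≠ 0 ∧ P ≠ 0 ∧ (∀ a : ℤ, Q ≠ a • P) ∧
    (∀ σ : absoluteGaloisGroup F, ∃ a b d : ℤ, σ • P = a • P ∧ σ • Q = b • P + d • Q ∧
        ((ρ₀ σ).val 0 0 - a : O) ∈ maximalIdeal O ∧ ((ρ₀ σ).val 1 1 - d : O) ∈ maximalIdeal O) ∧
    (∀ v : HeightOneSpectrum (𝓞 F), (p : 𝓞 F) ∈ v.asIdeal →
        ∀ 𝔓 ∈ v.primesAbove, ∀ σ ∈ 𝔓.inertia (absoluteGaloisGroup F), σ • P = P)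

/-- **COUSIN** of the datum `ρ₀` with ONE auxiliary place `q`: a curve as in `RealizedByCurve` which in
addition (i) has GOOD reduction at every `v ∣ p` (hence good ORDINARY there, `P` being inertia-fixed,
`p ≥ 5`, `e(F_v/ℚ_p) ≤ 2`), (ii) has good reduction at every residually-unramified place `v ≠ q`,
`v ∤ p` (the crux's level clause, read on the curve: `V_pE` is then unramified there; conversely at such
a place a potentially-good cousin of a twist-free datum is automatically good — prime-to-`p` inertia,
TRIAGE-r1-3 sharpen 2), (iii) has `SL₂(𝔽₃) ⊆ im ρ̄_{E,3}` (modularity input of CN23 Cor. 6.1.1(1):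
`ρ̄_{E,3}|_{F(ζ₃)}` absolutely irreducible; generic in the family by Hilbert irreducibility) and
(iv) irreducible `V_pE` (non-CM; Serre) — so that `r := V_pE` can be the seed. [folklore] -/
def Cousin (ρ₀ : absoluteGaloisGroup F →* Matrix.GeneralLinearGroup (Fin 2) O) : Prop :=
  ∃ (E : WeierstrassCurve F) (P Q : E.geomTorsion p) (q : HeightOneSpectrum (𝓞 F)),
    E.Δ ≠ 0 ∧ P ≠ 0 ∧ (∀ a : ℤ, Q ≠ a • P) ∧
    (∀ σ : absoluteGaloisGroup F, ∃ a b d : ℤ, σ • P = a • P ∧ σ • Q = b • P + d • Q ∧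
        ((ρ₀ σ).val 0 0 - a : O) ∈ maximalIdeal O ∧ ((ρ₀ σ).val 1 1 - d : O) ∈ maximalIdeal O) ∧
    (∀ v : HeightOneSpectrum (𝓞 F), (p : 𝓞 F) ∈ v.asIdeal →
        (∀ 𝔓 ∈ v.primesAbove, ∀ σ ∈ 𝔓.inertia (absoluteGaloisGroup F), σ • P = P) ∧
        E.HasGoodReductionAt v) ∧
    (∀ v : HeightOneSpectrum (𝓞 F), v ≠ q → (p : 𝓞 F) ∉ v.asIdeal →
        ResiduallyUnramifiedAt O ρ₀ v → E.HasGoodReductionAt v) ∧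
    (∃ ρ₃ : FramedGaloisRep F (ZMod 3) 2, E.IsTorsionGaloisRep 3 ρ₃ ∧
        ∀ g : Matrix.SpecialLinearGroup (Fin 2) (ZMod 3), ∃ σ, ρ₃ σ = Matrix.SpecialLinearGroup.toGL g) ∧
    (∀ [E.IsElliptic], (E.framedTateGaloisRep p).toGaloisRep.IsIrreducible)

end Regimes

/-! ## §2 The two imported dictionaries (named statements; the stubs assert them) -/

open Polynomial in
/-- **DICTIONARY `π ⇒ 𝕋(𝒰)`-point** (D1 of every card; Disproof §5 pin; TRIAGE cross-cutting note 2).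
For `F` imaginary quadratic: a cuspidal automorphic `π` of `GL₂(𝔸_F)` of weight zero (parallel weight
`2`, trivial coefficients) and a framed `r : Γ_F → GL₂(ℚ̄_p)` such that at every finite `v ∉ S`, `v ∤ p`,
`π_v` is unramified with Satake parameter `{a, b}` (unitary normalisation of `HasSatakeParamAt`: the
`T_{v,1}`-eigenvalue is `√q_v (a+b)`, the `T_{v,2} = S_v`-eigenvalue `ab`) and `r` is unramified with
ARITHMETIC-Frobenius polynomial `X² - ι⁻¹(√q_v(a+b)) X + ι⁻¹(q_v ab)` — then there is an `S ∪ S_p`-good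
tame level `𝒰` (`𝒰.bad ⊆ S ∪ {v ∣ p}`) with `𝒰.IsPadicallyAutomorphic r`: the Hecke eigensystem of
`π` on `H^•(X_{U_r}, ℤ_p)` (Eichler–Shimura–Harder for Bianchi manifolds; integrality of cohomological
eigenvalues; Franke) defines the continuous point `x : 𝕋(𝒰) → ℚ̄_p`, `x(T_{v,1}) = ι⁻¹(√q(a+b))`,
`x(T_{v,2}) = ι⁻¹(ab)`, and `heckeFrobPoly 2 q_v (x ∘ T_v) = X² - x(T_{v,1})X + q_v x(T_{v,2})` is
the stated polynomial (`Negative.trace_det_of_charpoly_eq_heckeFrobPoly`).  Harder 1987; Gee–Newton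
arXiv:1609.06965 §2.1, §3.3; Calegari–Emerton 2012 §2.  [size M/L; true in print, unbuilt in the tree] -/
def Dictionary (F : Type) [Field F] [NumberField F] (p : ℕ) [Fact p.Prime] : Prop :=
  ∀ (hcpt : isCompact_glFiniteIntegralLevel 2 F) (π : CuspidalAutomorphicRepData 2 F hcpt)
    (ι : PadicAlgCl p ≃+* ℂ) (r : FramedGaloisRep F (PadicAlgCl p) 2)
    (S : Finset (HeightOneSpectrum (𝓞 F))),
    π.1.HasWeightZero →
    (∀ v : HeightOneSpectrum (𝓞 F), v ∉ S → (p : 𝓞 F) ∉ v.asIdeal →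
      ∃ a b : ℂ, π.1.HasSatakeParamAt v {a, b} ∧ r.IsUnramifiedAt v ∧
        r.HasFrobCharpolyAt v
          (X ^ 2 - C (ι.symm (((Real.sqrt (v.residueCard : ℝ) : ℝ) : ℂ) * (a + b))) * X +
            C (ι.symm ((v.residueCard : ℂ) * (a * b))))) →
    ∃ 𝒰 : TameLevel 2 F p,
      (∀ v : HeightOneSpectrum (𝓞 F), v ∉ S → (p : 𝓞 F) ∉ v.asIdeal → v ∉ 𝒰.bad) ∧
        𝒰.IsPadicallyAutomorphic r

open Polynomial in
/-- **BIG-IMAGE MODULARITY** (the lever's borrowed theorem): Caraiani–Newton, arXiv:2301.10509,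
Cor. 6.1.1(1) (p. 87: `F` imaginary quadratic, `ρ̄_{E,3}|_{G_{F(ζ₃)}}` absolutely irreducible ⇒ `E`
modular) with Thm. 7.1(2) (p. 91: `E[3]` irreducible with image not the normaliser of a split Cartan ⇒
modular), specialised to the robust sufficient hypothesis `SL₂(𝔽₃) ⊆ im ρ̄_{E,3}` (then
`im ρ̄(G_{F(ζ₃)}) = im ρ̄ ∩ SL₂(𝔽₃) = SL₂(𝔽₃)`, absolutely irreducible; works also for `F = ℚ(√-3)`),
and with "modular" (p. 2: "a cuspidal `π` of parallel weight `2` whose `L`-function is that of `E`")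
read at the good places through `ι`: `π` has weight zero and at EVERY finite `w ∤ p` of good reduction
`π_w` is unramified with Satake parameter `{a, b}`, `√q_w(a+b) = a_w(E)`, and the arithmetic
Frobenius on `V_pE` (the tree's `framedTateGaloisRep`) has characteristic polynomial
`X² - ι⁻¹(√q(a+b))X + ι⁻¹(q ab)` `(= X² - a_wX + q_w)`.  [published theorem (10-author + ACC+ `P`-ordinary
lifting + 3–5 switch); XL to formalise; the tree vendors only Thm. 1.1 (`CaraianiNewton2023_modularity`,
all curves when `X₀(15)(F)` is finite), which does NOT cover a chosen cousin over a general `F`] -/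
def BigImageModularity (F : Type) [Field F] [NumberField F] (p : ℕ) [Fact p.Prime] : Prop :=
  ∀ (E : WeierstrassCurve F) [E.IsElliptic],
    (∃ ρ₃ : FramedGaloisRep F (ZMod 3) 2, E.IsTorsionGaloisRep 3 ρ₃ ∧
        ∀ g : Matrix.SpecialLinearGroup (Fin 2) (ZMod 3), ∃ σ, ρ₃ σ = Matrix.SpecialLinearGroup.toGL g) →
    ∀ (ι : PadicAlgCl p ≃+* ℂ),
      ∃ (hcpt : isCompact_glFiniteIntegralLevel 2 F) (π : CuspidalAutomorphicRepData 2 F hcpt),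
        π.1.HasWeightZero ∧
        ∀ w : HeightOneSpectrum (𝓞 F), (p : 𝓞 F) ∉ w.asIdeal → E.HasGoodReductionAt w →
          ∃ a b : ℂ, π.1.HasSatakeParamAt w {a, b} ∧
            (E.framedTateGaloisRep p).HasFrobCharpolyAt w
              (X ^ 2 - C (ι.symm (((Real.sqrt (w.residueCard : ℝ) : ℝ) : ℂ) * (a + b))) * X +
                C (ι.symm ((w.residueCard : ℂ) * (a * b))))

/-! ## §3 The stubs (`sorry` lives ONLY here) -/

/-- **D1 — `stub_dictionary`** (size M/L; shared).  Every imaginary quadratic `F` and prime `p` satisfy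
`Dictionary F p`.  Proof plan: `π` weight-0 cuspidal ⇒ `π^{K}` contributes to `H¹, H²` of the Bianchi
manifold of level `K = K_S · U_p(r) · ∏_{v ∉ S ∪ S_p} GL₂(𝒪_v)` (Harder 1987, Eichler–Shimura–Harder;
Borel–Wallach for trivial coefficients), with `[K t_{v,1} K] ↦ √q_v(a+b)`, `[K t_{v,2} K] ↦ ab`
(`HasSatakeParamAt`'s normalisation; algebraic integers, Clozel/Harder rationality) — so the
`ℤ_p`-integral eigensystem occurs in `H^i(X_{U_r}, 𝒪_E)` for the tame level `𝒰 := (K_S ∏ GL₂(𝒪_v),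
bad := S ∪ S_p)` (a `TameLevel`: open compact, factorizable and hyperspecial off `bad`), kills
`ker(𝕋(𝒰) → End H^i(X_{U_r}, 𝒪_E/p^s))` modulo `p^s`, hence extends to a CONTINUOUS `x : 𝕋(𝒰) → ℚ̄_p`
(Gee–Newton §2.1.3, Lemma 2.1.8; Calegari–Emerton §2); association = the hypothesis rewritten with
`Negative.trace_det_of_charpoly_eq_heckeFrobPoly` / `Disproof.heckeFrobPoly_two_eq`.  Why it might fail
AS TYPED: only through a mismatch between the tree's models (`levelCohomology` = group cohomology of
`GL₂(F)` on `Fun(GL₂(𝔸^∞)/U)^∨`, `heckeElement v i`) and the classical objects — to be confirmed by the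
prover against `CompletedCohomologyHeckeAlgebraGLn.lean` (named fact `heckeGenerators_commute` is NOT
needed for a `ℚ̄_p`-point).  Leans on: `TameLevel`, `IsPadicallyAutomorphic`, `heckeT`, `heckeFrobPoly`,
`CuspidalAutomorphicRepData`, `HasWeightZero`, `HasSatakeParamAt`, `levelCohomology`. -/
theorem stub_dictionary :
    ∀ (F : Type) [Field F] [NumberField F], IsTotallyComplex F → Module.finrank ℚ F = 2 →
      ∀ (p : ℕ) [Fact p.Prime], Dictionary F p := by
  sorry

/-- **S — `stub_bigImageModularity`** (published: CaraianiNewton2023 Cor. 6.1.1(1), Thm. 7.1(2);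
XL to formalise — it IS the 10-author/ACC+ machine plus CN's `P`-ordinary lifting and 3–5 switching).
Every imaginary quadratic `F` and prime `p` satisfy `BigImageModularity F p`.  Inside a formal proof the
honest route is to vendor Cor. 6.1.1 as a Literature named fact (with the unramified local–global
compatibility that "same `L`-function" means) and discharge this stub from it; listed here as a stub
because the crux is unconditional.  Why it might fail AS TYPED: only by a normalisation slip
(`√q(a+b)` vs `a_w`; arithmetic vs geometric Frobenius on `V_pE` vs `V_pE^∨` — both have polynomial
`X² - a_wX + q_w`, `hasFrobCharpolyAt_framedTateGaloisRepDual`), checked against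
`IsModularEllipticCurve` / `potentiallyModular_ellipticCurve_CM` (same `√q · α.sum = a_w` clause).
Leans on: `WeierstrassCurve.IsTorsionGaloisRep`, `framedTateGaloisRep`, `HasGoodReductionAt`,
`hasFrobCharpolyAt_framedTateGaloisRep_iff`, `CaraianiNewton2023_modularity` (the weaker vendored fact). -/
theorem stub_bigImageModularity :
    ∀ (F : Type) [Field F] [NumberField F], IsTotallyComplex F → Module.finrank ℚ F = 2 →
      ∀ (p : ℕ) [Fact p.Prime], BigImageModularity F p := by
  sorry

/-- **K2 — `stub_cousinSeed`** (THE STRUCTURAL HEART; size L; provable now modulo one cite-able fact).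
For an admissible datum over an imaginary quadratic `F`, `p ≥ 5`: a COUSIN gives the conclusion.
Proof plan (all twist-free): (1) `ι` from `PadicAlgCl.nonempty_ringEquiv_complex`; `E` is elliptic
(`Δ ≠ 0`); `π` from `BigImageModularity`.  (2) LATTICE: lift `(P, Q)` to a `ℤ_p`-basis `(P̃, Q̃)` of
`T_pE`, `b` the induced `ℚ_p`-basis of `V_pE`, `r := E.framedTateGaloisRepOfBasis p h b`: its matrices
lie in `GL₂(ℤ_p) ⊆ GL₂(O)`, giving `r₀` with `r.HasUpperTriangularIntegralModel r₀` (lower-left `≡ 0`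
because `⟨P⟩` is stable) and `DiagCongr O r₀ ρ₀` (the two congruences of `Cousin`).  (3) IRREDUCIBLE:
`V_pE` irreducible (clause (iv)) transported along `exists_conj_framedTateGaloisRep_eq_ofBasis`
(irreducibility is invariant under `FramedRep.conj`).  (4) POINT: `S := {v ∤ p : ¬ResiduallyUnramifiedAt
O ρ₀ v} ∪ {q}` is FINITE (from `Hyps`: `ρ` a.e. unramified, `ρ₀ ↦ ρ`, so a.e. residually unramified);
at `v ∉ S`, `v ∤ p` the cousin has good reduction (clause (ii)), so `BigImageModularity` gives the
Satake–Frobenius matching for `framedTateGaloisRep`, transported to `r` by `hasFrobCharpolyAt_conj_iff'`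
/ `isUnramifiedAt_conj_iff` (`Disproof.isPadicallyAutomorphic_conj_iff`); `Dictionary` yields `𝒰` with
`𝒰.bad ⊆ S ∪ S_p` and `𝒰.IsPadicallyAutomorphic r` — the level clause of `Concl` with the cousin's `q`.
(5) ORIENTATION at `v ∣ p` (weight `(k′, m′) = (2, 1)`): good reduction + `P` inertia-fixed ⇒ ordinary
(a supersingular `E[p]|_{I_v}` has no unramified line); `V_pE|_{D_v}` is the extension of the unramified
unit-root character `u` by `ε u⁻¹` (Tate module of the formal group — the ONE cite-able input,
Serre–Tate / Silverman VII, to be vendored if absent); the connected line reduces to `E[p]⁰ ≠ ⟨P̄⟩`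
(`ω|_{I_v} ≠ 1` as `e(F_v/ℚ_p) ≤ 2 < p - 1`), so in the frame `(P̃, Q̃)` its primitive generator
`(α, β)` has `β ∈ ℤ_p^×`, i.e. `‖Q₀₀‖ ≤ ‖Q₁₀‖` DIRECTLY; equivalently, the unit-root (quotient)
character `u` reduces to the character of the étale quotient `E[p]/E[p]⁰ ≅ ⟨P̄⟩`, which is
`χ̄_a = (r₀ σ)₀₀ mod 𝔪`, and `Negative.oriented_of_unitRoot_congr_toLocal` (one residually distinguished
`σ₀ ∈ Γ_{F_v}`, supplied by `Hyps`) returns the typed inequality; `θ₂ = u` is `1` on inertia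
(`m′ = 1`) and `θ₁ = ε u⁻¹ = ε` on inertia (`k′ = 2`).
Why it might fail AS TYPED: a normalisation slip between `HasSatakeParamAt` (`√q(a+b)`, `ab`) and
`heckeFrobPoly` (`x(T₁)`, `q x(T₂)`) — pinned by `Negative.BorelAndEisenstein`; or `IsIrreducible` of
`toGaloisRep` not matching the transported notion (same predicate, conj-invariant).  Leans on:
`framedTateGaloisRepOfBasis`, `exists_conj_framedTateGaloisRep_eq_ofBasis`, `isUnramifiedAt_conj_iff`,
`Negative.oriented_of_unitRoot_congr_toLocal`, `Negative.orientedFrame_diag_congr_toLocal`,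
`isPDistinguishedAt_iff`, `PadicAlgCl.nonempty_ringEquiv_complex`, `TameLevel.bad`. -/
theorem stub_cousinSeed :
    ∀ (F : Type) [Field F] [NumberField F], IsTotallyComplex F → Module.finrank ℚ F = 2 →
      ∀ (p : ℕ) [Fact p.Prime], 5 ≤ p → ∀ (O : ValuationSubring (PadicAlgCl p)),
        O = (Valued.v : Valuation (PadicAlgCl p) NNReal).valuationSubring →
        ∀ (ρ : FramedGaloisRep F (PadicAlgCl p) 2)
          (ρ₀ : absoluteGaloisGroup F →* Matrix.GeneralLinearGroup (Fin 2) O),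
          Hyps p O ρ ρ₀ → BigImageModularity F p → Dictionary F p → Cousin O ρ₀ → Concl p O ρ₀ := by
  sorry

/-- **K1 — `stub_cousinSupply`** (THE LINE'S LOAD-BEARING DIOPHANTINE STUB; OPEN as a universal
statement; finite search per datum).  For `p ∈ {5, 7}` over an imaginary quadratic `F`: if ONE elliptic
curve realises the residual pair cleanly (`RealizedByCurve`), then a clean modular COUSIN with one
auxiliary place exists.  Proof plan / why plausible: the realising point makes the twisted modular curve
`X := X_{χ̄_a}(p)` (moduli of `(E′, P′)` with `σP′ = χ̄_a(σ)P′`) isomorphic to `ℙ¹_F` (genus `0`;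
`p = 5`: conic with a point; `p = 7`: a `ℤ/3`-twist of `ℙ¹`, split by an odd-degree extension); every
`t ∈ X(F)` off the cusps realises the pair with the SAME characters (the congruences of `RealizedByCurve`
transfer verbatim).  Conditions on `t`: (a) good ORDINARY reduction with `P′` inertia-fixed at each
`v ∣ p` — an OPEN `v`-adic set, non-empty (Serre–Tate canonical lift of an ordinary `Ē₀/k_v` whose unit
root is `≡ χ̄_a(Frob_v)`: some trace `a ≡ χ̄_a(Frob_v) (mod p)` lies in the Hasse interval since
`4√q_v > p` for `p ≤ 7` — Waterhouse); (b) `SL₂(𝔽₃) ⊆ im ρ̄_{E′_t,3}` and `V_pE′_t` irreducible (no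
CM): off a THIN set (Hilbert irreducibility over `F`; CM `j`-values finite); (c) LEVEL: `j(t)` integral
at every residually-unramified `v ∤ p` except one `q` — with `T` the Hauptmodul of `X₀(p)`
(`j = (T²+10T+5)³/T` for `p = 5`) this is "`T(t)` supported on `S ∪ {q}`", `S :=` residual conductor
`∪ S_p`, i.e. an `S`-UNIT / one-floating-prime condition on a degree-2 rational function of `t`
(potentially good ⇒ good here: prime-to-`p` inertia acts unipotently mod `p`, hence trivially).
Weak approximation + Hilbert irreducibility give (a)+(b) for a dense set of `t`; (c) is the crux within
the crux: heuristically the number of admissible `t` of height `≤ X` grows like `(log X)^{#S}` (one of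
the two cusp forms must take `S`-unit values — a norm-form/Pell orbit or `S`-unit pairs —, the other an
`S`-unit times a prime power), so supply is infinite but polylogarithmically thin and NO existence
theorem is available (prime values on sparse sequences); a local obstruction (a fixed prime dividing
the second form along all `S`-unit solutions of the first) would falsify the stub for that datum.
Evidence: kit j008657 (ell-switch card) — genuine quartic datum `(ψ̄₁₇, ωψ̄₁₇⁻¹)` over `ℚ(√-2)`,
`p = 5` inert: ONE cousin `T = -9-4√-2 = q`, `N(q) = 113`, in `60 564` trials, `GL₂(𝔽₃)`-image
certified (TRIAGE-r1-1 App. B); wider counts j009591 / j010863 / j010975 queued at filing.  CHEAPEST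
FALSIFIER of the line: a headline datum (5-isogenous `E/F`, `rk X₀(15)(F) > 0`) with NO admissible `t`
up to height `10⁴` and a provable local obstruction.  Leans on: `geomTorsion`, `HasGoodReductionAt`,
`IsTorsionGaloisRep`, Mathlib `WeierstrassCurve.j`; literature: Kubert 1976 (Tate normal form),
Serre *Topics in Galois theory* §3 (HIT over number fields), Waterhouse 1969, Siegel/`S`-unit equations
(why per-`q` finiteness), CaraianiNewton2023 §7 (points on twisted modular curves `X(s3, b5)`). -/
theorem stub_cousinSupply :
    ∀ (F : Type) [Field F] [NumberField F], IsTotallyComplex F → Module.finrank ℚ F = 2 →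
      ∀ (p : ℕ) [Fact p.Prime], (p = 5 ∨ p = 7) → ∀ (O : ValuationSubring (PadicAlgCl p))
        (ρ₀ : absoluteGaloisGroup F →* Matrix.GeneralLinearGroup (Fin 2) O),
        RealizedByCurve O ρ₀ → Cousin O ρ₀ := by
  sorry

/-- **K3 — `stub_descendedSeed`** (the DESCENDED regime; size L/XL; theorem-grade in print for the
Billerey–Menares range, corners open).  If the ratio `χ̄_bχ̄_a⁻¹` extends to `θ : Γ_ℚ → κ^×`, the
conclusion holds.  Proof plan (card `descend-raise-basechange`, TRIAGE-r1-2/r1-3).  The pair is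
`χ̄_a ⊗ (1, θ|_{Γ_F})`; `χ̄_a` itself need not descend, so one realises `(1, θ̃)` over `ℚ` — `θ̃` the
extension of the ratio with `θ̃(c) = -1` (the two extensions differ by the odd `ε_F`, so exactly one
makes `1 ⊕ θ̃` ODD) — and twists at the end by the Teichmüller lift `χ̃_a` of `χ̄_a` (a character of
`Γ_F` with conductor inside the residual conductor `∪ S_p`; automorphically a Hecke character by global
class field theory — harmless for the level clause).  Steps: (i) Billerey–Menares arXiv:1604.01173
Thm 2 (p. 3, read by all three triagers): for `p ≥ 5`, `ρ̄ = ε₁ ⊕ ε₂ω^{k-1}` odd of Serre type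
`(N, k, ε)` with `p > k+1` and a prime `M ∤ Np`, `ρ̄` arises from a newform `g` of level `NM` iff
`(ε₁⁻¹ε₂)(M) M^k ≡ 1 (mod p)` (`(N,k) ≠ (1,2)`; Mazur's `M ≡ 1` for `(1,2)`; level exactly `NM` by
Carayol); (ii) `M` can be chosen INERT in `F` — always, by parity (`ηω^k` is even, `ε_F` odd:
TRIAGE-r1-3 sharpen) and Chebotarev — so `q := M𝓞_F` is ONE place; (iii) `g` is ordinary at `p`
(Eisenstein-congruent of weight `k ≤ p-2` and level prime to `p`: a supersingular `g` would have niveau-2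
inertia), unit root `≡ ε₁(p) = 1`; replace `g` by the weight-2 ordinary member of its Hida family (level
`NMp`, nebentypus at `p` — the level at `p` is free) to stay inside weight zero for D1; (iv) Langlands
quadratic base change (`ArthurClozel1989_weakLifting_cuspidal`; Langlands 1980) gives a weight-0
CUSPIDAL `Π` on `GL₂(𝔸_F)` (`g` is Steinberg at the inert `M`, so has no CM by `F`), unramified outside
`N𝓞_F ∪ {M𝓞_F} ∪ S_p`; the primes of `N` not under the residual conductor divide `d_F` (where `θ̃`
ramifies but `θ̃|_{Γ_F}` does not), and there `ρ_g|_{I_ℓ} = 1 ⊕ θ̃|_{I_ℓ}` is trivial on `I_𝔩`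
(ramified principal series), so `Π ⊗ χ_a` is unramified at every residually-unramified `v ∤ p`,
`v ≠ q`; (v) `r := (ρ_g|_{Γ_F} ⊗ χ̃_a)` framed by Ribet's lattice with residual sub `χ̄_a`
(`restrictField`, `FramedRep.twist`), irreducible (cuspidal, non-CM); ORIENTATION: the unit root of
`g` is its `p`-UNRAMIFIED constituent `ε₁ = 1`, a character of `Γ_ℚ`, hence `≡ χ̄_a χ̃_a⁻¹·χ̃_a = χ̄_a`
at EVERY place above `p` (uniform even at a split `p`, unlike dihedral data), then
`Negative.oriented_of_unitRoot_congr_toLocal`; (vi) D1 with `S :=` residual conductor `∪ {q}`.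
Print coverage: Serre weights `2 ≤ k ≤ p-2` with `ε₁, ε₂` unramified at `p` (BM18 Thm 2);
CORNERS NOT IN PRINT (why it might fail / stay open): inertial types with `χ̄_a|_{I_v}` of order `m > 1`
or `k ∈ {p-1, p}` (nebentypus-at-`p` Eisenstein level raising: Ohta / Ribet–Yoo territory), `p = 3`, and
the EXCEPTIONAL ratio `ω^{±1}` when `F ⊂ ℚ(ζ_p)` (`ℚ(√-p)`, `p ≡ 3 (4)`; `ℚ(i)`, `p ≡ 1 (4)`; `ℚ(√-3)`,
`p ≡ 1 (3)`): there Mazur's `M ≡ 1 (mod p)` forces `M` split, and tame level `p^∞` has no ordinary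
cuspidal Eisenstein congruence for `(1, ω)` (Kummer: `B_k/k ≡ 1/12`), so the one-`q` clause for that datum
rests on genuine Bianchi newforms of prime level (ideator-1 toy j009364: absorbed by torsion at 6/6 split
primes over `ℚ(i)`) — OPEN.  Leans on: `Descended`, `absGaloisRestrict`, `restrictField`,
`hasFrobCharpolyAt_restrictField_fin_two`, `ArthurClozel1989_weakLifting_cuspidal`, `IsNewform1`,
`IsGaloisRepOfNewform1Int`, `ModPGaloisRep.IsModular`, `Negative.oriented_of_unitRoot_congr_toLocal`,
`Dictionary`; literature BillereyMenares2018 Thm 1–2, Mazur 1977, Carayol, Hida 1986, Langlands 1980. -/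
theorem stub_descendedSeed :
    ∀ (F : Type) [Field F] [NumberField F], IsTotallyComplex F → Module.finrank ℚ F = 2 →
      ∀ (p : ℕ) [Fact p.Prime], p ≠ 2 → ∀ (O : ValuationSubring (PadicAlgCl p)),
        O = (Valued.v : Valuation (PadicAlgCl p) NNReal).valuationSubring →
        ∀ (ρ : FramedGaloisRep F (PadicAlgCl p) 2)
          (ρ₀ : absoluteGaloisGroup F →* Matrix.GeneralLinearGroup (Fin 2) O),
          Hyps p O ρ ρ₀ → Dictionary F p → Descended O ρ₀ → Concl p O ρ₀ := by
  sorry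

/-- **R — `stub_residualSeed`** (THE RESIDUAL; OPEN; = the crux on the complement of the line's reach;
no mechanism offered — TRIAGE-r1-2 coverage map "(G)", plus the elliptic-type data that need a
Teichmüller twist, see "Scope" in the module docstring).  For an admissible datum that is NOT descended
and NOT cleanly realised by a curve at `p ∈ {5,7}`, the conclusion holds.  What lives here: genuine pairs
with `χ̄_bχ̄_a⁻¹ ∉ ω·{𝔽_p^×-valued inverse squares}` or of Serre weight `≠ 2` inertial type, every
genuine pair at `p ∉ {5, 7}` (at `p = 3` no genuine pair is of elliptic type — the ratio `ω ā⁻² = ω`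
descends; at `p ≥ 11` the twisted `X₁(p)` is not rational), and twist-needing elliptic data.  Known approaches: the H-line cards
`ribet-dichotomy-hc1` ≈ `parallel-h2-eisenstein-symbol` (one-prime level raising of the PARALLEL
Eisenstein class; obstruction = new `𝔪`-torsion in `H²`, Calegari–Venkatesh; no forcing mechanism),
GL₂-type abelian-variety cousins with a degree-one prime (unprinted modularity input), or a planner
restatement (`Disproof.SeedFiniteAux`).  Heuristic (ideator-1 B-3): true — `Σ_q` of small congruence
probabilities diverges — but any proof must CONSTRUCT.  Why it might fail: this IS where a
counterexample to the crux would live (Disproof §7 D: a genuine `p`-distinguished pair all of whose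
oriented-ordinary pro-modular realisations need `≥ 2` auxiliary places).  `residualSeed_of_crux` shows
it is implied by the crux (no strengthening). -/
theorem stub_residualSeed :
    ∀ (F : Type) [Field F] [NumberField F], IsTotallyComplex F → Module.finrank ℚ F = 2 →
      ∀ (p : ℕ) [Fact p.Prime], p ≠ 2 → ∀ (O : ValuationSubring (PadicAlgCl p)),
        O = (Valued.v : Valuation (PadicAlgCl p) NNReal).valuationSubring →
        ∀ (ρ : FramedGaloisRep F (PadicAlgCl p) 2)
          (ρ₀ : absoluteGaloisGroup F →* Matrix.GeneralLinearGroup (Fin 2) O),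
          Hyps p O ρ ρ₀ → ¬ Descended O ρ₀ → ¬ ((p = 5 ∨ p = 7) ∧ RealizedByCurve O ρ₀) →
          Concl p O ρ₀ := by
  sorry

/-! ## §4 Composition (sorry-free): the stubs ⟹ the crux BY NAME -/

/-- **THE COMPOSITION.**  `EisensteinProModularSeed` BY NAME from D1, S, K2, K1, K3, R: re-bracket
(`crux_iff`), split on `Descended` (K3 fed by D1), then on `(p = 5 ∨ p = 7) ∧ RealizedByCurve`
(K1 supplies the cousin, S + D1 feed K2), the rest is R.  `sorry` only inside `stub_*`. -/
theorem EisensteinProModularSeed_of : EisensteinProModularSeed := by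
  rw [crux_iff]
  intro F _ _ hF hdeg p _ hp O hO ρ ρ₀ hh
  by_cases hD : Descended O ρ₀
  · exact stub_descendedSeed F hF hdeg p hp O hO ρ ρ₀ hh (stub_dictionary F hF hdeg p) hD
  · by_cases hE : (p = 5 ∨ p = 7) ∧ RealizedByCurve O ρ₀
    · have hp5 : 5 ≤ p := by
        rcases hE.1 with h | h <;> omega
      exact stub_cousinSeed F hF hdeg p hp5 O hO ρ ρ₀ hh (stub_bigImageModularity F hF hdeg p)
        (stub_dictionary F hF hdeg p) (stub_cousinSupply F hF hdeg p hE.1 O ρ₀ hE.2)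
    · exact stub_residualSeed F hF hdeg p hp O hO ρ ρ₀ hh hD hE

/-! ## §5 Honesty certificates (sorry-free) -/

/-- The residual stub R is IMPLIED by the crux (it is the crux restricted to a sub-population): R
neither weakens nor strengthens anything outside the line's reach. [folklore] -/
theorem residualSeed_of_crux (h : EisensteinProModularSeed) :
    ∀ (F : Type) [Field F] [NumberField F], IsTotallyComplex F → Module.finrank ℚ F = 2 →
      ∀ (p : ℕ) [Fact p.Prime], p ≠ 2 → ∀ (O : ValuationSubring (PadicAlgCl p)),
        O = (Valued.v : Valuation (PadicAlgCl p) NNReal).valuationSubring →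
        ∀ (ρ : FramedGaloisRep F (PadicAlgCl p) 2)
          (ρ₀ : absoluteGaloisGroup F →* Matrix.GeneralLinearGroup (Fin 2) O),
          Hyps p O ρ ρ₀ → ¬ Descended O ρ₀ → ¬ ((p = 5 ∨ p = 7) ∧ RealizedByCurve O ρ₀) →
          Concl p O ρ₀ :=
  fun F _ _ hF hdeg p _ hp O hO ρ ρ₀ hh _ _ => (crux_iff.mp h) F hF hdeg p hp O hO ρ ρ₀ hh

/-- K3 and the elliptic branch are likewise instances of the crux on their populations (so the three
regime stubs K3 / K2∘K1 / R partition the crux exactly, modulo D1 and S). [folklore] -/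
theorem descendedSeed_of_crux (h : EisensteinProModularSeed) :
    ∀ (F : Type) [Field F] [NumberField F], IsTotallyComplex F → Module.finrank ℚ F = 2 →
      ∀ (p : ℕ) [Fact p.Prime], p ≠ 2 → ∀ (O : ValuationSubring (PadicAlgCl p)),
        O = (Valued.v : Valuation (PadicAlgCl p) NNReal).valuationSubring →
        ∀ (ρ : FramedGaloisRep F (PadicAlgCl p) 2)
          (ρ₀ : absoluteGaloisGroup F →* Matrix.GeneralLinearGroup (Fin 2) O),
          Hyps p O ρ ρ₀ → Dictionary F p → Descended O ρ₀ → Concl p O ρ₀ :=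
  fun F _ _ hF hdeg p _ hp O hO ρ ρ₀ hh _ _ => (crux_iff.mp h) F hF hdeg p hp O hO ρ ρ₀ hh

/-- A COUSIN realises the datum (the first clauses of `Cousin` are those of `RealizedByCurve`): the
elliptic branch's input and output live in the same regime. [folklore] -/
theorem realizedByCurve_of_cousin {F : Type} [Field F] [NumberField F] {p : ℕ} [Fact p.Prime]
    {O : ValuationSubring (PadicAlgCl p)}
    {ρ₀ : absoluteGaloisGroup F →* Matrix.GeneralLinearGroup (Fin 2) O} (h : Cousin O ρ₀) :
    RealizedByCurve O ρ₀ := by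
  obtain ⟨E, P, Q, q, hΔ, hP, hQ, hpair, hp, -, -, -⟩ := h
  exact ⟨E, P, Q, hΔ, hP, hQ, hpair, fun v hv => (hp v hv).1⟩

end Summit.Langlands.Langlands.Cruxes.EisensteinProModularSeed.BigImageCousin

end
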